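import Mathlib
import HarnessLib
import Summits.CriticalPhenomena.Ising3DConformalLimit.Theses.PlantedPinning

/-!
# Strategist census s4 — typed attempts around `PlantedPinning.PinningEfficiencyDeficit`

Scratch file of the crux-strategist seat `cstrat-stmt-CriticalPhenomena-8451-s4`
(independent census, family `-s`).  Nothing here is a route item; the file only
certifies the *typed* statements quoted in `STRATEGY-CENSUS-s4.md`:

* `W0`  `FrequentDeficit` — the weakest replacement of the crux that still closes the
  route (`closes_of_frequentDeficit`), and `PinningEfficiencyDeficit → FrequentDeficit`;
* `S⁺`  the per-octave strengthening `DeficitAt p₀ ε₀ ∧ OctaveStability p₀ θ` (Σθ < ε₀)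
  and the proved assembly `frequentDeficit_of_octave`;
* `D-a` the abstract variance lemma `cv_lower_of_depression` (depression event of
  mass ≥ c and depth κ ⇒ second moment ≥ (1 + cκ²)·mean²), i.e. the proved assembly of
  the split `DepressionEvent → CS-slack`, together with the typed Ising-instance
  signatures `chiZ`, `csq`, `depressionMass`, `DepressionEvent`, `SlackWindow`.
-/

namespace Summit.CriticalPhenomena.Ising3DConformalLimit.Cruxes.PinningEfficiencyDeficit.StratS4

open scoped BigOperators Classical
open Literature.Probability.LatticeModels
open Summit.CriticalPhenomena.Ising3DConformalLimit.Theses.PlantedPinning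

noncomputable section

/-- β_c(3). -/
def βc : ℝ := Literature.Probability.LatticeModels.criticalBeta 3

/-- total magnetisation of the box Λ_L. -/
def M : ℕ → SpinConfig (Site 3) → ℝ :=
  fun L σ => ∑ x ∈ box 3 L, spinAt x σ

/-- conditional variance of `M` given the pins `P` planted from `η` (route's `cvar`). -/
def cvar : ℕ → Finset (Site 3) → SpinConfig (Site 3) → ℝ :=
  fun L P η => isingExpect (zdGraph 3) (box 3 L \ P) βc 0 (.fixed η) (fun σ => M L σ ^ 2)
    - isingExpect (zdGraph 3) (box 3 L \ P) βc 0 (.fixed η) (M L) ^ 2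

/-- planted weight of the pattern `τ` (= μ⁺_{Λ_L;β_c,0}(τ)). -/
def wτ (L : ℕ) (τ : ↥(box 3 L) → ℤˣ) : ℝ :=
  isingWeight (zdGraph 3) (box 3 L) βc 0 .plus τ / isingPartitionFunction (zdGraph 3) (box 3 L) βc 0 .plus

/-- planted conditional variance `v_{L,k}` (route's `pvar`). -/
def pvar : ℕ → ℕ → ℝ :=
  fun L k => (∑ P ∈ (box 3 L).powersetCard k, ∑ τ : ↥(box 3 L) → ℤˣ,
    isingWeight (zdGraph 3) (box 3 L) βc 0 .plus τ / isingPartitionFunction (zdGraph 3) (box 3 L) βc 0 .plus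
      * cvar L P (glue (box 3 L) τ .plus)) / ((box 3 L).card.choose k : ℝ)

/-- pinning efficiency `e_L(k)` (route's `eff`). -/
def eff : ℕ → ℕ → ℝ :=
  fun L k => (k : ℝ) * pvar L k / ((((box 3 L).card : ℝ) + 1) * (((box 3 L).card : ℝ) - k + 1))

/-- The crux, with the `let`-tower replaced by the closed terms above (definitional). -/
theorem deficit_iff :
    PinningEfficiencyDeficit ↔
      ∃ ε : ℝ, 0 < ε ∧ ∃ p₀ : ℝ, 0 < p₀ ∧ ∀ p : ℝ, 0 < p → p < p₀ → ∃ L₀ : ℕ, ∀ L ≥ L₀,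
        eff L ⌈p * ((box 3 L).card : ℝ)⌉₊ ≤ 1 - ε :=
  Iff.rfl

/-- `GaussianPinningSaturation` in the same closed terms (definitional). -/
theorem saturation_iff :
    GaussianPinningSaturation ↔
      ∀ (ρ : ℝ → ℝ) (Δ : ℝ) (S : CorrFamily 3), (∀ δ ∈ Set.Ioc (0:ℝ) 1, 0 < ρ δ) → 0 < Δ →
        HasPointwiseScalingLimit (criticalCorr 3) ρ S → IsNondegenerateTwoPoint S →
        IsMoebiusCovariant Δ S → ¬ HasNontrivialU4 S →
        ∀ ε : ℝ, 0 < ε → ∃ p₀ : ℝ, 0 < p₀ ∧ ∀ p : ℝ, 0 < p → p < p₀ → ∃ L₀ : ℕ, ∀ L ≥ L₀,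
          1 - ε ≤ eff L ⌈p * ((box 3 L).card : ℝ)⌉₊ :=
  Iff.rfl

/-! ## W0 — the weakest intermediate that still closes the route -/

/-- `W0`: a FIXED deficit ε witnessed at arbitrarily small densities and, for each such
density, along an unbounded sequence of box sizes.  Strictly weaker (as a formula) than the
crux: `∃ p₀ ∀ p < p₀` ↦ `∀ p₁ ∃ p < p₁`, `∃ L₀ ∀ L ≥ L₀` ↦ `∀ L₁ ∃ L ≥ L₁`. -/
def FrequentDeficit : Prop :=
  ∃ ε : ℝ, 0 < ε ∧ ∀ p₁ : ℝ, 0 < p₁ → ∃ p : ℝ, 0 < p ∧ p < p₁ ∧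
    ∀ L₁ : ℕ, ∃ L ≥ L₁, eff L ⌈p * ((box 3 L).card : ℝ)⌉₊ ≤ 1 - ε

theorem frequentDeficit_of_deficit (h : PinningEfficiencyDeficit) : FrequentDeficit := by
  obtain ⟨ε, hε, p₀, hp₀, hdef⟩ := deficit_iff.mp h
  refine ⟨ε, hε, fun p₁ hp₁ => ?_⟩
  have hmin : 0 < min p₀ p₁ := lt_min hp₀ hp₁
  have hle₀ : min p₀ p₁ ≤ p₀ := min_le_left p₀ p₁
  have hle₁ : min p₀ p₁ ≤ p₁ := min_le_right p₀ p₁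
  refine ⟨min p₀ p₁ / 2, by linarith, by linarith, fun L₁ => ?_⟩
  obtain ⟨L₀, hL₀⟩ := hdef (min p₀ p₁ / 2) (by linarith) (by linarith)
  exact ⟨max L₀ L₁, le_max_right _ _, hL₀ _ (le_max_left _ _)⟩

/-- `W0` closes the route exactly as the crux does (same `closes` proof, the contradiction
is read off at one density `p < p₁(ε/2)` and one large `L`). -/
theorem closes_of_frequentDeficit :
    FrequentDeficit → GaussianPinningSaturation → MoebiusLimitExists →
      _root_.Ising3DConformalLimit := by
  intro hFD hSat hMoeb
  obtain ⟨ρ, Δ, S, hρ, hΔ, hlim, hnd, hmob⟩ := hMoeb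
  refine ⟨ρ, Δ, S, hρ, hΔ, hlim, hnd, hmob, ?_⟩
  by_contra hU4
  obtain ⟨ε, hε, hfd⟩ := hFD
  obtain ⟨p₁, hp₁, hsat⟩ :=
    saturation_iff.mp hSat ρ Δ S hρ hΔ hlim hnd hmob hU4 (ε / 2) (by linarith)
  obtain ⟨p, hp, hpp₁, hfreq⟩ := hfd p₁ hp₁
  obtain ⟨L₁, hL₁⟩ := hsat p hp hpp₁
  obtain ⟨L, hL, hdefL⟩ := hfreq L₁
  have h₁ := hL₁ L hL
  linarith

/-! ## S⁺ — per-octave strengthening (base at one density + summable octave losses) -/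

/-- deficit `ε₀` at the single density `p₀`, for all large `L`. -/
def DeficitAt (p₀ ε₀ : ℝ) : Prop :=
  ∃ L₀ : ℕ, ∀ L ≥ L₀, eff L ⌈p₀ * ((box 3 L).card : ℝ)⌉₊ ≤ 1 - ε₀

/-- octave stability: halving the density costs at most `θ k` efficiency at the k-th octave. -/
def OctaveStability (p₀ : ℝ) (θ : ℕ → ℝ) : Prop :=
  ∀ k : ℕ, ∃ L₀ : ℕ, ∀ L ≥ L₀,
    eff L ⌈p₀ / 2 ^ (k + 1) * ((box 3 L).card : ℝ)⌉₊
      ≤ eff L ⌈p₀ / 2 ^ k * ((box 3 L).card : ℝ)⌉₊ + θ k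

/-- The strengthening's assembly: base + summable octave losses below the base deficit
give `W0` (hence close the route via `closes_of_frequentDeficit`). -/
theorem frequentDeficit_of_octave {p₀ ε₀ : ℝ} {θ : ℕ → ℝ} (hp₀ : 0 < p₀)
    (hθ : ∀ k, 0 ≤ θ k) (hsum : Summable θ) (hgap : ∑' k, θ k < ε₀)
    (hbase : DeficitAt p₀ ε₀) (hstep : OctaveStability p₀ θ) : FrequentDeficit := by
  have key : ∀ k : ℕ, ∃ L₀ : ℕ, ∀ L ≥ L₀,
      eff L ⌈p₀ / 2 ^ k * ((box 3 L).card : ℝ)⌉₊ ≤ 1 - ε₀ + ∑ i ∈ Finset.range k, θ i := by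
    intro k
    induction k with
    | zero =>
      obtain ⟨L₀, hL₀⟩ := hbase
      refine ⟨L₀, fun L hL => ?_⟩
      simpa using hL₀ L hL
    | succ k ih =>
      obtain ⟨L₀, hL₀⟩ := ih
      obtain ⟨L₀', hL₀'⟩ := hstep k
      refine ⟨max L₀ L₀', fun L hL => ?_⟩
      have h1 := hL₀ L (le_trans (le_max_left _ _) hL)
      have h2 := hL₀' L (le_trans (le_max_right _ _) hL)
      rw [Finset.sum_range_succ]
      linarith
  refine ⟨ε₀ - ∑' k, θ k, by linarith, fun p₁ hp₁ => ?_⟩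
  obtain ⟨k, hk⟩ := pow_unbounded_of_one_lt (p₀ / p₁) (by norm_num : (1:ℝ) < 2)
  have hk' : p₀ / 2 ^ k < p₁ := by
    rw [div_lt_iff₀ (by positivity)]
    rw [div_lt_iff₀ hp₁] at hk
    linarith [mul_comm p₁ ((2:ℝ) ^ k)]
  refine ⟨p₀ / 2 ^ k, by positivity, hk', fun L₁ => ?_⟩
  obtain ⟨L₀, hL₀⟩ := key k
  refine ⟨max L₀ L₁, le_max_right _ _, ?_⟩
  have h := hL₀ (max L₀ L₁) (le_max_left _ _)
  have hpart : ∑ i ∈ Finset.range k, θ i ≤ ∑' i, θ i :=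
    hsum.sum_le_tsum (Finset.range k) (fun i _ => hθ i)
  linarith

/-! ## D-a — depression event ⇒ Cauchy–Schwarz slack (abstract assembly, proved) -/

/-- Abstract form of the split `DepressionEvent → CS-slack`: on a finite weighted space,
if an event `E` of mass ≥ `c` sees the variable `χ` depressed below `(1-κ)·mean`, then
`Σ w χ² ≥ (1 + c κ²)·(Σ w χ)²`, i.e. the squared coefficient of variation is ≥ `c κ²`.
In the crux `s, E, w, χ` are: the planted triple ensemble (P a j-subset, τ ∼ μ⁺, z ∉ P),
its weights, and `χ = χ_z(P,τ) = Cov(M, σ_z | pins)`; then `Σwχ²/(Σwχ)² = csq/pvar²`. -/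
theorem wsum_sq_expand {ι : Type*} (s : Finset ι) (w χ : ι → ℝ) (μ : ℝ)
    (hw1 : ∑ i ∈ s, w i = 1) (hμ : ∑ i ∈ s, w i * χ i = μ) :
    ∑ i ∈ s, w i * χ i ^ 2 = μ ^ 2 + ∑ i ∈ s, w i * (χ i - μ) ^ 2 := by
  have h' : ∑ i ∈ s, w i * (χ i - μ) ^ 2
      = ∑ i ∈ s, (w i * χ i ^ 2 - 2 * μ * (w i * χ i) + μ ^ 2 * w i) := by
    apply Finset.sum_congr rfl
    intro i _
    ring
  rw [h', Finset.sum_add_distrib, Finset.sum_sub_distrib, ← Finset.mul_sum, ← Finset.mul_sum,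
    hμ, hw1]
  ring

theorem cv_lower_of_depression {ι : Type*} (s E : Finset ι) (hE : E ⊆ s)
    (w χ : ι → ℝ) (hw : ∀ i ∈ s, 0 ≤ w i) (hw1 : ∑ i ∈ s, w i = 1)
    (κ c : ℝ) (hκ : 0 ≤ κ) (hμ : 0 ≤ ∑ i ∈ s, w i * χ i)
    (hmass : c ≤ ∑ i ∈ E, w i)
    (hdep : ∀ i ∈ E, χ i ≤ (1 - κ) * ∑ j ∈ s, w j * χ j) :
    (1 + c * κ ^ 2) * (∑ i ∈ s, w i * χ i) ^ 2 ≤ ∑ i ∈ s, w i * χ i ^ 2 := by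
  obtain ⟨μ, hμe⟩ : ∃ μ : ℝ, ∑ i ∈ s, w i * χ i = μ := ⟨_, rfl⟩
  simp only [hμe] at hμ hdep ⊢
  rw [wsum_sq_expand s w χ μ hw1 hμe]
  have h1 : ∑ i ∈ E, w i * (χ i - μ) ^ 2 ≤ ∑ i ∈ s, w i * (χ i - μ) ^ 2 :=
    Finset.sum_le_sum_of_subset_of_nonneg hE (fun i hi _ => mul_nonneg (hw i hi) (sq_nonneg _))
  have h2 : ∑ i ∈ E, w i * (κ * μ) ^ 2 ≤ ∑ i ∈ E, w i * (χ i - μ) ^ 2 := by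
    apply Finset.sum_le_sum
    intro i hi
    apply mul_le_mul_of_nonneg_left _ (hw i (hE hi))
    have hd := hdep i hi
    have hnn : 0 ≤ κ * μ := mul_nonneg hκ hμ
    have hle : κ * μ ≤ μ - χ i := by nlinarith
    calc (κ * μ) ^ 2 ≤ (μ - χ i) ^ 2 := pow_le_pow_left₀ hnn hle 2
      _ = (χ i - μ) ^ 2 := by ring
  have h3 : c * (κ * μ) ^ 2 ≤ ∑ i ∈ E, w i * (κ * μ) ^ 2 := by
    rw [← Finset.sum_mul]
    exact mul_le_mul_of_nonneg_right hmass (sq_nonneg _)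
  have expand : (1 + c * κ ^ 2) * μ ^ 2 = μ ^ 2 + c * (κ * μ) ^ 2 := by ring
  rw [expand]
  linarith

/-! ## Typed Ising-instance signatures quoted in the census (no proofs) -/

/-- local conditional susceptibility `χ_z(P,τ) = Cov(M, σ_z | pins P planted from τ)`
(the summand of the lead's `csq`). -/
def chiZ (L : ℕ) (P : Finset (Site 3)) (τ : ↥(box 3 L) → ℤˣ) (z : Site 3) : ℝ :=
  isingExpect (zdGraph 3) (box 3 L \ P) βc 0 (.fixed (glue (box 3 L) τ .plus))
      (fun σ => M L σ * spinAt z σ)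
    - isingExpect (zdGraph 3) (box 3 L \ P) βc 0 (.fixed (glue (box 3 L) τ .plus)) (M L)
      * isingExpect (zdGraph 3) (box 3 L \ P) βc 0 (.fixed (glue (box 3 L) τ .plus))
          (fun σ => spinAt z σ)

/-- the lead's `csq L j = (n choose j)⁻¹ Σ_{|P|=j} Σ_τ w(τ) (n-j) Σ_{z∉P} χ_z(P,τ)²`. -/
def csq (L j : ℕ) : ℝ :=
  (∑ P ∈ (box 3 L).powersetCard j, ∑ τ : ↥(box 3 L) → ℤˣ,
      wτ L τ * ((((box 3 L).card : ℝ) - j) * ∑ z ∈ box 3 L \ P, chiZ L P τ z ^ 2))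
    / ((box 3 L).card.choose j : ℝ)

/-- CS-slack `s` at density `p` in the dyadic window below `⌈p n⌉` (the registered stub
`stub_csSlackWindow` is `∃ s > 0, ∃ p₀ > 0, ∀ p ∈ (0,p₀), SlackWindow s p`). -/
def SlackWindow (s p : ℝ) : Prop :=
  ∃ L₀ : ℕ, ∀ L ≥ L₀, ∀ j : ℕ,
    ⌈p * ((box 3 L).card : ℝ)⌉₊ ≤ 2 * j → j < ⌈p * ((box 3 L).card : ℝ)⌉₊ →
      (1 + s) * pvar L j ^ 2 ≤ csq L j

/-- mean of `χ_z` over the planted triple ensemble (P uniform j-subset, τ planted,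
z uniform in Λ∖P); by the fluctuation–response identity `Σ_{z∉P} χ_z = Var(M | P,τ)` it
equals `pvar L j / (n - j)`. -/
def chiMean (L j : ℕ) : ℝ :=
  (∑ P ∈ (box 3 L).powersetCard j, ∑ τ : ↥(box 3 L) → ℤˣ,
      wτ L τ * ((∑ z ∈ box 3 L \ P, chiZ L P τ z) / (((box 3 L).card : ℝ) - j)))
    / ((box 3 L).card.choose j : ℝ)

/-- mass, under the planted triple ensemble, of the depression event
`{χ_z(P,τ) ≤ (1-κ)·chiMean}`. -/
def depressionMass (L j : ℕ) (κ : ℝ) : ℝ :=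
  (∑ P ∈ (box 3 L).powersetCard j, ∑ τ : ↥(box 3 L) → ℤˣ,
      wτ L τ * ((((box 3 L \ P).filter (fun z => chiZ L P τ z ≤ (1 - κ) * chiMean L j)).card : ℝ)
        / (((box 3 L).card : ℝ) - j)))
    / ((box 3 L).card.choose j : ℝ)

/-- `D-a`, hard piece: a depression event of mass ≥ c and depth κ, uniformly at small
density in the dyadic window.  With `cv_lower_of_depression` (+ the bookkeeping identity
`csq/pvar² = E[χ²]/E[χ]²` over the triple ensemble) it gives `SlackWindow (c κ²) p`. -/
def DepressionEvent : Prop :=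
  ∃ c : ℝ, 0 < c ∧ ∃ κ : ℝ, 0 < κ ∧ ∃ p₀ : ℝ, 0 < p₀ ∧ ∀ p : ℝ, 0 < p → p < p₀ →
    ∃ L₀ : ℕ, ∀ L ≥ L₀, ∀ j : ℕ,
      ⌈p * ((box 3 L).card : ℝ)⌉₊ ≤ 2 * j → j < ⌈p * ((box 3 L).card : ℝ)⌉₊ →
        c ≤ depressionMass L j κ

/-- `D-b`, easy piece (provable-now in every dimension, also satisfied by the lattice GFF):
a deficit at ONE high density. -/
def HighDensityDeficit : Prop :=
  ∃ p₀ : ℝ, 0 < p₀ ∧ p₀ < 1 ∧ ∃ ε₀ : ℝ, 0 < ε₀ ∧ DeficitAt p₀ ε₀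

/-- `D-b`, hard piece: octave stability with losses summing below the base deficit. -/
def SummableOctaveLoss : Prop :=
  ∃ p₀ : ℝ, 0 < p₀ ∧ ∃ ε₀ : ℝ, 0 < ε₀ ∧ DeficitAt p₀ ε₀ ∧
    ∃ θ : ℕ → ℝ, (∀ k, 0 ≤ θ k) ∧ Summable θ ∧ ∑' k, θ k < ε₀ ∧ OctaveStability p₀ θ

theorem frequentDeficit_of_summableOctaveLoss (h : SummableOctaveLoss) : FrequentDeficit := by
  obtain ⟨p₀, hp₀, ε₀, _, hbase, θ, hθ, hsum, hgap, hstep⟩ := h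
  exact frequentDeficit_of_octave hp₀ hθ hsum hgap hbase hstep

end

end Summit.CriticalPhenomena.Ising3DConformalLimit.Cruxes.PinningEfficiencyDeficit.StratS4
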